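import Mathlib
import Literature.MathematicalPhysics.QuantumFieldTheory.Balaban1983to89.QGQInverse

/-! # `Balaban1983to89.B9SectEKernel` — the finite-dimensional skeleton of B9 Sect. E (unit-lattice propagators):
constrained-minimum characterisation of `(QG₁Q*)⁻¹`, the `γ₀` assembly, the `C*Δ_kC` sandwich, and the
`x`-uniform decay of the resolvent family `(C*Δ_kC + x)⁻¹` behind B10 (63) / B13 (2.7), kernel-checked

CITATION HEADER. Supports the reading (unit `b2b-balaban-r1-g4`, reader group A gen 4, cell pub-balaban) of
T. Balaban, *Propagators for lattice gauge theories in a background field*, Commun. Math. Phys. 99 (1985) 389–434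
[`Balaban1985BackgroundPropagators`] (= B9), Sect. E pp. 427–428 [PDF 39–40] (renders
`1985-cmp99-background-propagators-p039-x2.png`, `…-p040-x2.png`):
*"e^{½⟨g,C^{(k)}(Λ)g⟩} = (Z^{(k)}(Λ))^{−1}∫dB↾_Λ δ(Q₁B)δ_{Ax}(B)·exp[−½⟨H₁B, G₁^{−1}H₁B⟩ + ½a⟨B,B⟩ + ⟨H₁D̃^{(2)}(B), J⟩
+ ⟨B, g⟩] (3.155)"*, *"⟨B,(QG₁Q*)^{−1}B⟩ − a⟨B,B⟩ − 2⟨H₁D̃^{(2)}(B), J⟩ = ⟨B, Δ_kB⟩ (3.156). This form is considered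
on the subspace {B : B = 0 on Λᶜ, B = 0 on ⋃_{y∈Λ′}Ax(y), Q₁B = 0} … B = CB̃ … C^{(k)}(Λ) = C(C*Δ_kC)^{−1}C*, or
(C*Δ_kC)^{−1} = C̃^{(k)}(Λ) = C^{(k)}(Λ)↾_Λ̃ (3.158) … It is more convenient to work with the operator C̃^{(k)}(Λ),
because it is defined by a positive definite operator C*Δ_kC with a lower bound γ₀ > 0 independent of k and U. We
have proved it in [4], Lemma 2.4, for operators with U = 1. Localizing the operators in Δ_k and using the methods of
Sect. B we can prove it for C*Δ_kC with an arbitrary configuration U satisfying (3.35), (3.36) with Mα₀ sufficiently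
small"* (GAPS G-B9-09: asserted, proved nowhere in print), and *"(3.159) … × Z_k^{−1}∫dA δ(QA − B)δ_R(RD*A)
exp[−½⟨A,(Δ + Δ^{(2)})A⟩]"*; and of the two consumers
T. Balaban, *Ultraviolet stability of three-dimensional lattice pure gauge field theories*, Commun. Math. Phys. 102
(1985) 255–275 [`Balaban1985UV3`] (= B10), pp. 271–272 [PDF 17–18] (renders
`1985-cmp102-uv-stability-3d-p017-x2.png`, `…-p018-x2.png`): *"we obtain the Gaussian integral determined by the
positive quadratic form ⟨A, C*Δ_kCA⟩"*, *"The number γ₁ is an upper bound of the positive, bounded operator C*Δ_kC"*,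
(63) *"½ log det(C*Δ_kC)^{−1} = ½∫₀^{2γ₁}dx Tr(C*Δ_kC + xI)^{−1} − ½C*Δ_kC + Σ_{n≥1}((−1)ⁿ/2n)(2γ₁)^{−n}(C*Δ_kC)ⁿ"*,
*"(C*Δ_kC + xI)^{−1} = (I + D̄μ)QG̃₃(x)Q*(I + μ*D̄*)↾ … The operator G̃₃(x) has the same properties as G̃₂"*
(GAPS G-B10-06), and T. Balaban, *Renormalization group approach to lattice gauge field theories. II*,
Commun. Math. Phys. 116 (1988) 1–22 [`Balaban1988RG2Cluster`] (= B13), p. 13 (2.7)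
*"(C^{(k)})^{1/2} = (C*Δ_kC)^{−1/2} = (1/π)∫₀^∞ dx x^{−1/2}(xI + C*Δ_kC)^{−1} …"* (GAPS G-B13-05 (a)).

WHAT THIS FILE CERTIFIES (kernel; finite index sets, real scalars; `S` plays `G₁⁻¹ = K + aQ*Q`, `P` plays
`(QG₁Q*)⁻¹ = H₁*G₁⁻¹H₁`, `H` plays `H₁ = G₁Q*(QG₁Q*)⁻¹`, characterised inverse-free by `QH = 1`, `SH = QᵀP`):
1. `extension_energy`, `constrained_min`, `lower_transfer`, `form_le_of_right_inverse` — the Schur-complement /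
   Gaussian-marginal variational principle that IS the content of (3.155)–(3.156) and (3.159):
   `⟨B, PB⟩ = min {⟨A, SA⟩ : QA = B}`, attained at `A = HB`; hence every lower bound of the constrained energy in
   terms of `QA` is a lower bound of `P`, and every right inverse `M` of `Q` gives the upper bound `⟨B,PB⟩ ≤ ⟨MB, SMB⟩`.
2. `form_add_gauss`, `coercive_sub_of_energy_lower` — the `−a⟨B,B⟩` of (3.156): with `S = K + a QᵀQ`,
   `γ‖QA‖² ≤ ⟨A, KA⟩ (∀A)` gives `P − a ≥ γ`.
3. `gamma0_assembly` — the LOGIC of the γ₀ claim of p. 428 as repaired in `HOME/b2b-balaban-r1/SectE-interface-proof.md`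
   §5: from (h1) a covariant-Stokes-type bound `F(QA) ≤ κ₁⟨A,KA⟩ + κ₂‖QA‖²`, (h2) a covariant Lemma-2.4′-type bound
   `c‖B‖² ≤ F(B)` on the admissible subspace, (hJ) `|⟨B, 𝒥B⟩| ≤ θ‖B‖²` for the J-term, conclude
   `⟨B, (P − a − 𝒥)B⟩ ≥ ((c − κ₂)/κ₁ − θ)‖B‖²` on the admissible subspace; and `coercive_sandwich_of_range` — the
   passage to `C*Δ_kC ≥ γ₀` of (3.157)–(3.158) (`C` maps into the admissible subspace and `‖CB̃‖ ≥ ‖B̃‖`).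
4. `coercive_add_smul_one`, `resolvent_decay_uniform` — for the resolvent family of B10 (63) / B13 (2.7):
   coercivity `γ` and the exponentially weighted off-diagonal sums of `T = C*Δ_kC` give
   `|(T + x)⁻¹(i,j)| ≤ (γ − ρ)⁻¹e^{−κ d(i,j)}` UNIFORMLY in `x ≥ 0` (via `QGQInverse.inverse_decay`), i.e. the
   sup-kernel part of "G̃₃(x) has the same properties as G̃₂", uniformly on the whole integration range.
5. `form_ge_rel_of_perturbation`, `weighted_coercive_of_inverse_bound` — the two form-level devices of the written
   repair: a form-small perturbation costs only a RELATIVE factor `(1 − τ/γ)`, and a weighted bound on the inverse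
   `⟨Wy, S⁻¹Wy⟩ ≤ c⟨y, Wy⟩` gives the weighted coercivity `⟨x, Sx⟩ ≥ c⁻¹⟨x, Wx⟩` (quantitative positivity of
   `G₁⁻¹` from Theorem 3.12's L²-entries + Theorem 3.11's positivity + Lemma 2.1 [B6]).
6. `ims_localization`, `ims_lower` — the IMS localisation formula `Σ_s⟨h_s x, K h_s x⟩ = ⟨x,Kx⟩ − ½⟨x,Ex⟩`,
   `E(i,j) = K(i,j)Σ_s(h_s(i) − h_s(j))²`, for an arbitrary matrix and quadratic partition of unity, with the Schur
   bound on the error: the device by which the covariant Lemma 2.4′ is proved cube by cube (local axial gauges need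
   `|V − 1|` small only on one M-cube at a time — this is where "Mα₀ sufficiently small" of p. 428 enters).
WHAT IT DOES NOT CERTIFY: the analytic inputs (h1), (h2), (hJ) and the off-diagonal decay of `C*Δ_kC` — these are
WRITTEN (from printed statements of B9 Thms 3.3/3.11/3.12, (3.69), (3.133), (3.36), B7 Props 1–4 with (139)–(147),
B6 Lemmas 2.1/2.4 (corrected constant, G-B6-09R) and the r1-g3 repair of (3.132)) in
`HOME/b2b-balaban-r1/SectE-interface-proof.md`, with the one delicate reading flagged there (R-M: the transport
structure of the composed linear averaging operator); nor anything at the level of generalized random-walk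
expansions (GAPS G-B9-10 (a)(b) as refined by C-adv8-2 stay open). Value = precise gap repair + kernel certificate
of its finite-dimensional skeleton, NOT summit progress. Elementary; [folklore] (Schur complement / constrained
Gaussian minimisation; resolvent monotonicity; Combes–Thomas). -/

namespace Literature.MathematicalPhysics.QuantumFieldTheory.Balaban1983to89.B9SectEKernel

open Matrix Finset QGQInverse

variable {n m : Type*} [Fintype n] [DecidableEq n] [Fintype m] [DecidableEq m]

/-! ## 0. Two dot-product helpers -/

omit [DecidableEq n] in
/-- `⟨u, Sv⟩ = ⟨Su, v⟩` for symmetric `S`. [folklore] -/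
theorem dot_mulVec_symm {S : Matrix n n ℝ} (hS : S.IsSymm) (u v : n → ℝ) :
    u ⬝ᵥ (S *ᵥ v) = (S *ᵥ u) ⬝ᵥ v := by
  rw [Matrix.dotProduct_mulVec, ← Matrix.mulVec_transpose, hS.eq]

omit [DecidableEq n] [DecidableEq m] in
/-- `⟨A, Qᵀλ⟩ = ⟨QA, λ⟩`. [folklore] -/
theorem dot_transpose_mulVec (Q : Matrix m n ℝ) (A : n → ℝ) (lam : m → ℝ) :
    A ⬝ᵥ (Qᵀ *ᵥ lam) = (Q *ᵥ A) ⬝ᵥ lam := by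
  rw [Matrix.mulVec_transpose, dotProduct_comm, ← Matrix.dotProduct_mulVec, dotProduct_comm]

/-! ## 1. The constrained minimum: `⟨B, PB⟩ = min {⟨A, SA⟩ : QA = B}` (B9 (3.155)–(3.156), (3.159))

Setting: `S` (playing `G₁⁻¹`) symmetric with nonnegative form; `Q` the (rectangular) averaging operator; the pair
`(H, P)` (playing `H₁ = G₁Q*(QG₁Q*)⁻¹`, `P = (QG₁Q*)⁻¹`) is characterised WITHOUT inverses by the two identities
`Q H = 1` (H is a right inverse of Q: B9 (3.110)/(3.126)) and `S H = Qᵀ P` (the Lagrange condition: `G₁⁻¹H₁ =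
Q*(QG₁Q*)⁻¹`).  Then `H₁*G₁⁻¹H₁ = P` (`extension_energy`, = the passage (3.155) → (3.156)) and `P` is the minimum of
the constrained energy (`constrained_min`, = the Gaussian integral (3.159) evaluated). -/

section variational

omit [DecidableEq n] in
/-- `⟨HB, S HB⟩ = ⟨B, PB⟩`: the energy of the canonical extension (B9: `⟨H₁B, G₁⁻¹H₁B⟩ = ⟨B,(QG₁Q*)⁻¹B⟩`,
(3.155) → (3.156)). [folklore] -/
theorem extension_energy (S : Matrix n n ℝ) (Q : Matrix m n ℝ) (H : Matrix n m ℝ) (P : Matrix m m ℝ)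
    (hQH : Q * H = 1) (hSH : S * H = Qᵀ * P) (B : m → ℝ) :
    (H *ᵥ B) ⬝ᵥ (S *ᵥ (H *ᵥ B)) = B ⬝ᵥ (P *ᵥ B) := by
  have hSw : S *ᵥ (H *ᵥ B) = Qᵀ *ᵥ (P *ᵥ B) := by
    rw [Matrix.mulVec_mulVec, hSH, ← Matrix.mulVec_mulVec]
  have hQw : Q *ᵥ (H *ᵥ B) = B := by rw [Matrix.mulVec_mulVec, hQH, Matrix.one_mulVec]
  rw [hSw, dot_transpose_mulVec, hQw]

omit [DecidableEq n] in
/-- **Constrained minimum.** For every `A` with `QA = B`: `⟨B, PB⟩ ≤ ⟨A, SA⟩` (expand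
`0 ≤ ⟨A − HB, S(A − HB)⟩` and use `S HB = QᵀPB`, `Q HB = B = QA`).  Variational content of B9 (3.159): the Gaussian
integral over `{QA = B}` with density `exp(−½⟨A, SA⟩)` equals `const·exp(−½ min)`. [folklore] -/
theorem constrained_min (S : Matrix n n ℝ) (hS : S.IsSymm) (hpos : ∀ v : n → ℝ, 0 ≤ v ⬝ᵥ (S *ᵥ v))
    (Q : Matrix m n ℝ) (H : Matrix n m ℝ) (P : Matrix m m ℝ) (hQH : Q * H = 1) (hSH : S * H = Qᵀ * P)
    (A : n → ℝ) (B : m → ℝ) (hAB : Q *ᵥ A = B) :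
    B ⬝ᵥ (P *ᵥ B) ≤ A ⬝ᵥ (S *ᵥ A) := by
  set w := H *ᵥ B with hw
  have hSw : S *ᵥ w = Qᵀ *ᵥ (P *ᵥ B) := by
    rw [hw, Matrix.mulVec_mulVec, hSH, ← Matrix.mulVec_mulVec]
  have hQw : Q *ᵥ w = B := by rw [hw, Matrix.mulVec_mulVec, hQH, Matrix.one_mulVec]
  have hAw : A ⬝ᵥ (S *ᵥ w) = B ⬝ᵥ (P *ᵥ B) := by rw [hSw, dot_transpose_mulVec, hAB]
  have hww : w ⬝ᵥ (S *ᵥ w) = B ⬝ᵥ (P *ᵥ B) := by rw [hSw, dot_transpose_mulVec, hQw]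
  have h0 := hpos (A - w)
  have e : (A - w) ⬝ᵥ (S *ᵥ (A - w))
      = A ⬝ᵥ (S *ᵥ A) - 2 * (A ⬝ᵥ (S *ᵥ w)) + w ⬝ᵥ (S *ᵥ w) := by
    rw [Matrix.mulVec_sub, sub_dotProduct, dotProduct_sub, dotProduct_sub]
    have e1 : w ⬝ᵥ (S *ᵥ A) = A ⬝ᵥ (S *ᵥ w) := by rw [dot_mulVec_symm hS, dotProduct_comm]
    rw [e1]; ring
  rw [e, hAw, hww] at h0
  linarith

omit [DecidableEq n] in
/-- **Transfer of lower bounds.** If a functional `f` of the averaged field is dominated by the energy,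
`f(QA) ≤ ⟨A, SA⟩` for EVERY `A`, then `f(B) ≤ ⟨B, PB⟩` (test with `A = HB`).  This is how a lower bound for
`Δ_k` of (3.156) is obtained from a lower bound of the constrained fine-lattice energy. [folklore] -/
theorem lower_transfer (S : Matrix n n ℝ) (Q : Matrix m n ℝ) (H : Matrix n m ℝ) (P : Matrix m m ℝ)
    (hQH : Q * H = 1) (hSH : S * H = Qᵀ * P) (f : (m → ℝ) → ℝ)
    (hf : ∀ A : n → ℝ, f (Q *ᵥ A) ≤ A ⬝ᵥ (S *ᵥ A)) (B : m → ℝ) :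
    f B ≤ B ⬝ᵥ (P *ᵥ B) := by
  have h := hf (H *ᵥ B)
  rwa [Matrix.mulVec_mulVec, hQH, Matrix.one_mulVec, extension_energy S Q H P hQH hSH] at h

omit [DecidableEq n] in
/-- Coercivity version of `lower_transfer`: `γ‖QA‖² ≤ ⟨A, SA⟩ (∀A)` ⇒ `P` coercive with `γ`. [folklore] -/
theorem coercive_of_energy_lower (S : Matrix n n ℝ) (Q : Matrix m n ℝ) (H : Matrix n m ℝ) (P : Matrix m m ℝ)
    (hQH : Q * H = 1) (hSH : S * H = Qᵀ * P) {γ : ℝ}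
    (h : ∀ A : n → ℝ, γ * ((Q *ᵥ A) ⬝ᵥ (Q *ᵥ A)) ≤ A ⬝ᵥ (S *ᵥ A)) : Coercive P γ :=
  fun B => lower_transfer S Q H P hQH hSH (fun B => γ * (B ⬝ᵥ B)) h B

omit [DecidableEq n] in
/-- **Transfer of upper bounds.** Every right inverse `M` of `Q` (`QM = 1`) bounds `P` from above:
`⟨B, PB⟩ ≤ ⟨MB, S MB⟩`.  Source of the printed-nowhere UPPER bound `γ₁` of `C*Δ_kC` used by B10 p. 272 l. 1–2 and
B13 (2.7) (GAPS G-B10-06 (i)). [folklore] -/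
theorem form_le_of_right_inverse (S : Matrix n n ℝ) (hS : S.IsSymm) (hpos : ∀ v : n → ℝ, 0 ≤ v ⬝ᵥ (S *ᵥ v))
    (Q : Matrix m n ℝ) (H : Matrix n m ℝ) (P : Matrix m m ℝ) (hQH : Q * H = 1) (hSH : S * H = Qᵀ * P)
    (M : Matrix n m ℝ) (hQM : Q * M = 1) (B : m → ℝ) :
    B ⬝ᵥ (P *ᵥ B) ≤ (M *ᵥ B) ⬝ᵥ (S *ᵥ (M *ᵥ B)) :=
  constrained_min S hS hpos Q H P hQH hSH (M *ᵥ B) B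
    (by rw [Matrix.mulVec_mulVec, hQM, Matrix.one_mulVec])

omit [DecidableEq n] in
/-- Upper bound of `P` from one energy-bounded right inverse: `⟨MB, SMB⟩ ≤ c‖B‖² (∀B)` ⇒ `⟨B,PB⟩ ≤ c‖B‖²`.
[folklore] -/
theorem form_upper_of_test (S : Matrix n n ℝ) (hS : S.IsSymm) (hpos : ∀ v : n → ℝ, 0 ≤ v ⬝ᵥ (S *ᵥ v))
    (Q : Matrix m n ℝ) (H : Matrix n m ℝ) (P : Matrix m m ℝ) (hQH : Q * H = 1) (hSH : S * H = Qᵀ * P)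
    (M : Matrix n m ℝ) (hQM : Q * M = 1) {c : ℝ}
    (hM : ∀ B : m → ℝ, (M *ᵥ B) ⬝ᵥ (S *ᵥ (M *ᵥ B)) ≤ c * (B ⬝ᵥ B)) (B : m → ℝ) :
    B ⬝ᵥ (P *ᵥ B) ≤ c * (B ⬝ᵥ B) :=
  (form_le_of_right_inverse S hS hpos Q H P hQH hSH M hQM B).trans (hM B)

/-! ### The `−a⟨B, B⟩` of (3.156) -/

omit [DecidableEq n] [DecidableEq m] in
/-- With `S = K + a QᵀQ` (B9: `G₁⁻¹ = (Δ_π ∓ Δ_π^{(2)} + DRD*) + aQ*Q`, (3.128)–(3.130)):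
`⟨A, SA⟩ = ⟨A, KA⟩ + a‖QA‖²`. [folklore] -/
theorem form_add_gauss (K : Matrix n n ℝ) (Q : Matrix m n ℝ) (a : ℝ) (A : n → ℝ) :
    A ⬝ᵥ ((K + a • (Qᵀ * Q)) *ᵥ A) = A ⬝ᵥ (K *ᵥ A) + a * ((Q *ᵥ A) ⬝ᵥ (Q *ᵥ A)) := by
  rw [Matrix.add_mulVec, dotProduct_add, Matrix.smul_mulVec, dotProduct_smul, smul_eq_mul,
    ← Matrix.mulVec_mulVec, dot_transpose_mulVec]

omit [DecidableEq n] in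
/-- **(3.156), the `QG₁Q*` part.** If the constrained `K`-energy dominates `γ‖QA‖²` then
`(QG₁Q*)⁻¹ − a = P − a·1` is coercive with `γ` (in particular nonnegative for `γ = 0`: the sign of `+½a⟨B,B⟩` in
(3.155) is the right one). [folklore] -/
theorem coercive_sub_of_energy_lower (K : Matrix n n ℝ) (Q : Matrix m n ℝ) (a : ℝ) (H : Matrix n m ℝ)
    (P : Matrix m m ℝ) (hQH : Q * H = 1) (hSH : (K + a • (Qᵀ * Q)) * H = Qᵀ * P) {γ : ℝ}
    (h : ∀ A : n → ℝ, γ * ((Q *ᵥ A) ⬝ᵥ (Q *ᵥ A)) ≤ A ⬝ᵥ (K *ᵥ A)) :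
    Coercive (P - a • (1 : Matrix m m ℝ)) γ := by
  intro B
  have h1 : ∀ A : n → ℝ, (γ + a) * ((Q *ᵥ A) ⬝ᵥ (Q *ᵥ A)) ≤ A ⬝ᵥ ((K + a • (Qᵀ * Q)) *ᵥ A) := by
    intro A; rw [form_add_gauss, add_mul]; linarith [h A]
  have h2 := coercive_of_energy_lower _ Q H P hQH hSH h1 B
  rw [Matrix.sub_mulVec, dotProduct_sub, Matrix.smul_mulVec, Matrix.one_mulVec, dotProduct_smul,
    smul_eq_mul]
  linarith

/-! ### The γ₀ assembly (logic of `SectE-interface-proof.md` §5) and the `C*Δ_kC` sandwich (3.157)–(3.158) -/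

omit [DecidableEq n] in
/-- **γ₀ assembly.** `S = K + aQᵀQ`, `(H, P)` as above, `good` the admissible subspace of (3.156)
(`B = 0` off `Λ`, axial gauge, `Q₁B = 0`), `F` a nonnegative-type functional (the covariant curvature-plus-average form
of Lemma 2.4′), `Jm` the symmetric matrix of the J-term `2⟨H₁D̃^{(2)}(B), J⟩`.  From
(h1) `F(QA) ≤ κ₁⟨A, KA⟩ + κ₂‖QA‖²` for all fine fields `A` (covariant Stokes ∘ quantitative positivity, §5.2–5.4),
(h2) `c‖B‖² ≤ F(B)` for admissible `B` (covariant Lemma 2.4′, §5.5), (hJ) `|⟨B, Jm B⟩| ≤ θ‖B‖²` (§5.6), conclude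
`⟨B, (P − a − Jm)B⟩ ≥ ((c − κ₂)/κ₁ − θ)‖B‖²` for admissible `B` — i.e. `Δ_k ≥ γ₀′` on the subspace of (3.156).
[folklore] -/
theorem gamma0_assembly (K : Matrix n n ℝ) (Q : Matrix m n ℝ) (a : ℝ) (H : Matrix n m ℝ) (P Jm : Matrix m m ℝ)
    (hQH : Q * H = 1) (hSH : (K + a • (Qᵀ * Q)) * H = Qᵀ * P) (good : (m → ℝ) → Prop)
    (F : (m → ℝ) → ℝ) {κ₁ κ₂ c θ : ℝ} (hκ₁ : 0 < κ₁)
    (h1 : ∀ A : n → ℝ, F (Q *ᵥ A) ≤ κ₁ * (A ⬝ᵥ (K *ᵥ A)) + κ₂ * ((Q *ᵥ A) ⬝ᵥ (Q *ᵥ A)))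
    (h2 : ∀ B : m → ℝ, good B → c * (B ⬝ᵥ B) ≤ F B)
    (hJ : ∀ B : m → ℝ, |B ⬝ᵥ (Jm *ᵥ B)| ≤ θ * (B ⬝ᵥ B)) (B : m → ℝ) (hB : good B) :
    ((c - κ₂) / κ₁ - θ) * (B ⬝ᵥ B) ≤ B ⬝ᵥ ((P - a • (1 : Matrix m m ℝ) - Jm) *ᵥ B) := by
  -- the functional dominated by the full energy ⟨A, SA⟩ = ⟨A, KA⟩ + a‖QA‖²
  have hf : ∀ A : n → ℝ, κ₁⁻¹ * (F (Q *ᵥ A) - κ₂ * ((Q *ᵥ A) ⬝ᵥ (Q *ᵥ A))) + a * ((Q *ᵥ A) ⬝ᵥ (Q *ᵥ A))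
      ≤ A ⬝ᵥ ((K + a • (Qᵀ * Q)) *ᵥ A) := by
    intro A
    rw [form_add_gauss]
    have hA := h1 A
    have : κ₁⁻¹ * (F (Q *ᵥ A) - κ₂ * ((Q *ᵥ A) ⬝ᵥ (Q *ᵥ A))) ≤ A ⬝ᵥ (K *ᵥ A) := by
      rw [inv_mul_le_iff₀ hκ₁]; linarith
    linarith
  have hP := lower_transfer _ Q H P hQH hSH
    (fun B => κ₁⁻¹ * (F B - κ₂ * (B ⬝ᵥ B)) + a * (B ⬝ᵥ B)) hf B
  have hFB := h2 B hB
  have hJB := hJ B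
  have hJB' : B ⬝ᵥ (Jm *ᵥ B) ≤ θ * (B ⬝ᵥ B) := (le_abs_self _).trans hJB
  have hmono : κ₁⁻¹ * (c * (B ⬝ᵥ B) - κ₂ * (B ⬝ᵥ B)) ≤ κ₁⁻¹ * (F B - κ₂ * (B ⬝ᵥ B)) :=
    mul_le_mul_of_nonneg_left (by linarith) (inv_nonneg.mpr hκ₁.le)
  rw [Matrix.sub_mulVec, Matrix.sub_mulVec, dotProduct_sub, dotProduct_sub, Matrix.smul_mulVec,
    Matrix.one_mulVec, dotProduct_smul, smul_eq_mul]
  have e : ((c - κ₂) / κ₁ - θ) * (B ⬝ᵥ B) = κ₁⁻¹ * (c * (B ⬝ᵥ B) - κ₂ * (B ⬝ᵥ B)) - θ * (B ⬝ᵥ B) := by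
    rw [div_eq_inv_mul]; ring
  rw [e]
  linarith

omit [DecidableEq m] in
/-- **Sandwich (3.157)–(3.158).** If `C` maps every reduced field into the admissible subspace, does not decrease
norms (`‖CB̃‖ ≥ ‖B̃‖`: `C` is the identity on the `Λ̃`-bonds), and `T` (playing `Δ_k`) is bounded below by `γ ≥ 0` on the
admissible subspace, then `CᵀTC` (playing `C*Δ_kC`) is coercive with `γ`. [folklore] -/
theorem coercive_sandwich_of_range {p : Type*} [Fintype p] (T : Matrix m m ℝ) (C : Matrix m p ℝ)
    (good : (m → ℝ) → Prop) {γ : ℝ} (hγ : 0 ≤ γ) (hgood : ∀ v : p → ℝ, good (C *ᵥ v))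
    (hC : ∀ v : p → ℝ, v ⬝ᵥ v ≤ (C *ᵥ v) ⬝ᵥ (C *ᵥ v))
    (hT : ∀ B : m → ℝ, good B → γ * (B ⬝ᵥ B) ≤ B ⬝ᵥ (T *ᵥ B)) :
    Coercive (Cᵀ * T * C) γ := by
  intro v
  have e : v ⬝ᵥ ((Cᵀ * T * C) *ᵥ v) = (C *ᵥ v) ⬝ᵥ (T *ᵥ (C *ᵥ v)) := by
    rw [← Matrix.mulVec_mulVec, ← Matrix.mulVec_mulVec, dot_transpose_mulVec]
  rw [e]
  exact (mul_le_mul_of_nonneg_left (hC v) hγ).trans (hT (C *ᵥ v) (hgood v))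

omit [DecidableEq m] in
/-- Upper sandwich: `T ≤ γ₁` and `‖Cv‖² ≤ c‖v‖²` give `CᵀTC ≤ γ₁c` (the UPPER bound γ₁ of C*Δ_kC of B10 p. 272, from an
upper bound of Δ_k — `form_upper_of_test` — and the norm of the local operator `C`). [folklore] -/
theorem form_sandwich_le {p : Type*} [Fintype p] (T : Matrix m m ℝ) (C : Matrix m p ℝ) {γ₁ c : ℝ}
    (hγ₁ : 0 ≤ γ₁) (hT : ∀ u : m → ℝ, u ⬝ᵥ (T *ᵥ u) ≤ γ₁ * (u ⬝ᵥ u))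
    (hC : ∀ v : p → ℝ, (C *ᵥ v) ⬝ᵥ (C *ᵥ v) ≤ c * (v ⬝ᵥ v)) (v : p → ℝ) :
    v ⬝ᵥ ((Cᵀ * T * C) *ᵥ v) ≤ γ₁ * c * (v ⬝ᵥ v) := by
  have e : v ⬝ᵥ ((Cᵀ * T * C) *ᵥ v) = (C *ᵥ v) ⬝ᵥ (T *ᵥ (C *ᵥ v)) := by
    rw [← Matrix.mulVec_mulVec, ← Matrix.mulVec_mulVec, dot_transpose_mulVec]
  rw [e]
  calc (C *ᵥ v) ⬝ᵥ (T *ᵥ (C *ᵥ v)) ≤ γ₁ * ((C *ᵥ v) ⬝ᵥ (C *ᵥ v)) := hT _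
    _ ≤ γ₁ * (c * (v ⬝ᵥ v)) := mul_le_mul_of_nonneg_left (hC v) hγ₁
    _ = γ₁ * c * (v ⬝ᵥ v) := by ring

end variational

/-! ## 2. The resolvent family `(T + x)⁻¹`, `x ≥ 0` (B10 (63): `∫₀^{2γ₁} dx Tr(C*Δ_kC + xI)⁻¹`; B13 (2.7):
`(C*Δ_kC)^{−1/2} = π⁻¹∫₀^∞ dx x^{−1/2}(xI + C*Δ_kC)⁻¹`) -/

section resolvent

omit [DecidableEq n] in
/-- Shifting by `x·1` shifts the coercivity constant by `x`. [folklore] -/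
theorem coercive_add_smul_one [DecidableEq n] {S : Matrix n n ℝ} {γ : ℝ} (hS : Coercive S γ) (x : ℝ) :
    Coercive (S + x • (1 : Matrix n n ℝ)) (γ + x) := by
  intro v
  rw [Matrix.add_mulVec, dotProduct_add, Matrix.smul_mulVec, Matrix.one_mulVec, dotProduct_smul,
    smul_eq_mul, add_mul]
  linarith [hS v]

/-- **x-uniform decay of the resolvent kernel.** Under the hypotheses of `QGQInverse.inverse_decay` for `T`
(coercivity `γ`, pseudo-metric `d`, `(e^{κd} − 1)`-weighted absolute row/column sums `≤ ρ < γ` — the diagonal carries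
weight zero, so the hypotheses do not see the shift), EVERY member of the resolvent family satisfies the SAME bound:
`|(T + x·1)⁻¹(i,j)| ≤ (γ − ρ)⁻¹e^{−κ d(i,j)}` for all `x ≥ 0`.  This is the sup-kernel half of B10's/B13's "G̃₃(x) has
the same properties as G̃₂", uniformly over the whole x-range of (63)/(2.7) (GAPS G-B10-06 (ii), G-B13-05 (a));
the random-walk/localisation half is NOT asserted here. [folklore] -/
theorem resolvent_decay_uniform (T : Matrix n n ℝ) (d : n → n → ℝ) {γ κ ρ : ℝ}
    (hργ : ρ < γ) (hκ : 0 ≤ κ) (hT : Coercive T γ)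
    (hd_symm : ∀ i j, d i j = d j i) (hd_zero : ∀ i, d i i = 0)
    (hd_tri : ∀ i j k, d i k ≤ d i j + d j k)
    (hrow : ∀ i, ∑ j, |T i j| * (Real.exp (κ * d i j) - 1) ≤ ρ)
    (hcol : ∀ j, ∑ i, |T i j| * (Real.exp (κ * d i j) - 1) ≤ ρ)
    {x : ℝ} (hx : 0 ≤ x) (i j : n) :
    |(T + x • (1 : Matrix n n ℝ))⁻¹ i j| ≤ (γ - ρ)⁻¹ * Real.exp (-(κ * d i j)) := by
  have hw : ∀ i j, |(T + x • (1 : Matrix n n ℝ)) i j| * (Real.exp (κ * d i j) - 1)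
      = |T i j| * (Real.exp (κ * d i j) - 1) := by
    intro i j
    by_cases hij : i = j
    · subst hij
      rw [hd_zero, mul_zero, Real.exp_zero, sub_self, mul_zero, mul_zero]
    · rw [Matrix.add_apply, Matrix.smul_apply, Matrix.one_apply_ne hij, smul_zero, add_zero]
  have h1 := inverse_decay (T + x • (1 : Matrix n n ℝ)) d (γ := γ + x) (κ := κ) (ρ := ρ)
    (by linarith) hκ (coercive_add_smul_one hT x) hd_symm hd_zero hd_tri
    (fun i => by simp_rw [hw]; exact hrow i) (fun j => by simp_rw [hw]; exact hcol j) i j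
  have h2 : (γ + x - ρ)⁻¹ ≤ (γ - ρ)⁻¹ := by
    apply inv_anti₀ <;> linarith
  exact h1.trans (mul_le_mul_of_nonneg_right h2 (Real.exp_pos _).le)

/-- The crude member of the same family: `|(T + x·1)⁻¹(i,j)| ≤ (γ + x)⁻¹ ≤ γ⁻¹` for `x ≥ 0` (boundedness of
`G̃₃(x)`-type resolvents uniformly in `x`, from coercivity alone). [folklore] -/
theorem resolvent_entry_le (T : Matrix n n ℝ) {γ : ℝ} (hγ : 0 < γ) (hT : Coercive T γ) {x : ℝ} (hx : 0 ≤ x)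
    (i j : n) : |(T + x • (1 : Matrix n n ℝ))⁻¹ i j| ≤ γ⁻¹ := by
  have h1 := inv_entry_le_of_coercive (S := T + x • (1 : Matrix n n ℝ)) (γ := γ + x) (by linarith)
    (coercive_add_smul_one hT x) i j
  have h2 : (γ + x)⁻¹ ≤ γ⁻¹ := by apply inv_anti₀ <;> linarith
  exact h1.trans h2

end resolvent

/-! ## 3. Two form-level devices of the written repair -/

section devices

omit [DecidableEq n] in
/-- **Relative smallness.** A perturbation that is form-small in absolute terms, `|⟨x, Tx⟩| ≤ τ‖x‖²`, of a coercive `S`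
(`γ > 0`) costs only the RELATIVE factor `1 − τ/γ`: `⟨x, (S + T)x⟩ ≥ (1 − τ/γ)⟨x, Sx⟩`.  (Used for `Δ′`, the curvature
part of the Hessian, against the weighted positivity of `G₁⁻¹`.) [folklore] -/
theorem form_ge_rel_of_perturbation {S T : Matrix n n ℝ} {γ τ : ℝ} (hγ : 0 < γ) (hτ : 0 ≤ τ)
    (hS : Coercive S γ) (hT : ∀ x : n → ℝ, |x ⬝ᵥ (T *ᵥ x)| ≤ τ * (x ⬝ᵥ x)) (x : n → ℝ) :
    (1 - τ / γ) * (x ⬝ᵥ (S *ᵥ x)) ≤ x ⬝ᵥ ((S + T) *ᵥ x) := by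
  rw [Matrix.add_mulVec, dotProduct_add]
  have h1 := hS x
  have h3 : -(τ * (x ⬝ᵥ x)) ≤ x ⬝ᵥ (T *ᵥ x) := by linarith [neg_abs_le (x ⬝ᵥ (T *ᵥ x)), hT x]
  have h4 : τ / γ * (γ * (x ⬝ᵥ x)) ≤ τ / γ * (x ⬝ᵥ (S *ᵥ x)) :=
    mul_le_mul_of_nonneg_left h1 (div_nonneg hτ hγ.le)
  have e : τ / γ * (γ * (x ⬝ᵥ x)) = τ * (x ⬝ᵥ x) := by
    field_simp
  rw [e] at h4
  nlinarith

/-- **Weighted coercivity from a weighted bound on the inverse.** `Δ` symmetric, invertible, with nonnegative form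
(playing `G₁⁻¹`, positive by Thm 3.11/3.12); `w` a weight (playing `(L^jη)^{−2}` on the scale-`j` region); if the
inverse satisfies `⟨w·y, Δ⁻¹(w·y)⟩ ≤ c⟨y, w·y⟩` (Schur test on the kernel `w^{1/2}G₁w^{1/2}` via Thm 3.3 (3.46) + B6
Lemma 2.1), then `⟨x, Δx⟩ ≥ c⁻¹⟨x, w·x⟩` for every `x` (test `μ = c⁻¹ w·x` in
`QGQInverse.two_dot_sub_form_le_inv_form`). [folklore] -/
theorem weighted_coercive_of_inverse_bound (Δ : Matrix n n ℝ) (hsymm : Δ.IsSymm) (hunit : IsUnit Δ)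
    (hpos : ∀ v : n → ℝ, 0 ≤ v ⬝ᵥ (Δ *ᵥ v)) (w : n → ℝ) {c : ℝ} (hc : 0 < c)
    (hG : ∀ y : n → ℝ, (w * y) ⬝ᵥ (Δ⁻¹ *ᵥ (w * y)) ≤ c * (y ⬝ᵥ (w * y))) (x : n → ℝ) :
    c⁻¹ * (x ⬝ᵥ (w * x)) ≤ x ⬝ᵥ (Δ *ᵥ x) := by
  have h := two_dot_sub_form_le_inv_form Δ hsymm hunit hpos x (c⁻¹ • (w * x))
  simp only [dotProduct_smul, Matrix.mulVec_smul, smul_dotProduct, smul_eq_mul] at h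
  have h2 := hG x
  have hc' : 0 ≤ c⁻¹ := inv_nonneg.mpr hc.le
  have h3 : c⁻¹ * (c⁻¹ * ((w * x) ⬝ᵥ (Δ⁻¹ *ᵥ (w * x)))) ≤ c⁻¹ * (c⁻¹ * (c * (x ⬝ᵥ (w * x)))) :=
    mul_le_mul_of_nonneg_left (mul_le_mul_of_nonneg_left h2 hc') hc'
  have e : c⁻¹ * (c⁻¹ * (c * (x ⬝ᵥ (w * x)))) = c⁻¹ * (x ⬝ᵥ (w * x)) := by
    field_simp
  rw [e] at h3
  linarith

end devices

/-! ## 4. IMS localisation (the device of `SectE-interface-proof.md` §5.5: Lemma 2.4′ is applied cube by cube) -/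

section ims

omit [DecidableEq n] in
/-- `⟨u, Mv⟩` as a double sum. [folklore] -/
theorem dot_mulVec_eq_sum (M : Matrix n n ℝ) (u v : n → ℝ) :
    u ⬝ᵥ (M *ᵥ v) = ∑ i, ∑ j, u i * M i j * v j := by
  simp only [dotProduct, Matrix.mulVec, Finset.mul_sum]
  exact Finset.sum_congr rfl fun i _ => Finset.sum_congr rfl fun j _ => by ring

/-- The localisation-error matrix `E(i,j) = K(i,j)·Σ_s (h_s(i) − h_s(j))²` of a quadratic partition of unity
`Σ_s h_s² = 1`. [folklore] -/
def imsError {ι : Type*} [Fintype ι] (K : Matrix n n ℝ) (h : ι → n → ℝ) : Matrix n n ℝ :=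
  Matrix.of fun i j => K i j * ∑ s, (h s i - h s j) ^ 2

omit [DecidableEq n] in
/-- **IMS localisation formula** (Ismagilov–Morgan–Simon–Sigal, lattice/matrix form): for ANY matrix `K` and any
quadratic partition of unity `Σ_s h_s(i)² = 1`,
`Σ_s ⟨h_s x, K h_s x⟩ = ⟨x, Kx⟩ − ½ ⟨x, E x⟩`, `E(i,j) = K(i,j) Σ_s (h_s(i) − h_s(j))²`.
No symmetry is needed.  For a finite-range `K` and partition functions varying on scale `M`, `E` is supported near the
cube boundaries and is `O(range²/M²)`-small entrywise. [folklore] -/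
theorem ims_localization {ι : Type*} [Fintype ι] (K : Matrix n n ℝ) (h : ι → n → ℝ)
    (hpart : ∀ i, ∑ s, h s i ^ 2 = 1) (x : n → ℝ) :
    ∑ s, (h s * x) ⬝ᵥ (K *ᵥ (h s * x)) = x ⬝ᵥ (K *ᵥ x) - (1 / 2) * (x ⬝ᵥ (imsError K h *ᵥ x)) := by
  have hsq : ∀ i j, ∑ s, (h s i - h s j) ^ 2 = 2 - 2 * ∑ s, h s i * h s j := by
    intro i j
    have e : ∀ s, (h s i - h s j) ^ 2 = (h s i ^ 2 + h s j ^ 2) - 2 * (h s i * h s j) := fun s => by ring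
    simp_rw [e]
    rw [Finset.sum_sub_distrib, Finset.sum_add_distrib, ← Finset.mul_sum, hpart, hpart]
    ring
  simp_rw [dot_mulVec_eq_sum, Pi.mul_apply, imsError, Matrix.of_apply, hsq]
  rw [Finset.sum_comm]
  rw [Finset.mul_sum, ← Finset.sum_sub_distrib]
  refine Finset.sum_congr rfl fun i _ => ?_
  rw [Finset.sum_comm]
  rw [Finset.mul_sum, ← Finset.sum_sub_distrib]
  refine Finset.sum_congr rfl fun j _ => ?_
  have e : ∑ s, h s i * x i * K i j * (h s j * x j) = (x i * K i j * x j) * ∑ s, h s i * h s j := by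
    rw [Finset.mul_sum]
    exact Finset.sum_congr rfl fun s _ => by ring
  rw [e]
  ring

omit [DecidableEq n] in
/-- The localisation error is form-bounded by the Schur test on `E`: weighted absolute row and column sums
`Σ_j |K(i,j)| Σ_s (h_s(i) − h_s(j))² ≤ ε` give `|⟨x, Ex⟩| ≤ ε‖x‖²`, hence
`⟨x, Kx⟩ ≥ Σ_s ⟨h_s x, K h_s x⟩ − (ε/2)‖x‖²` — a lower bound proved cube by cube transfers to the whole volume at the
price `ε/2`. [folklore] -/
theorem ims_lower {ι : Type*} [Fintype ι] (K : Matrix n n ℝ) (h : ι → n → ℝ)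
    (hpart : ∀ i, ∑ s, h s i ^ 2 = 1) {ε : ℝ} (hε : 0 ≤ ε)
    (hrow : ∀ i, ∑ j, |K i j| * ∑ s, (h s i - h s j) ^ 2 ≤ ε)
    (hcol : ∀ j, ∑ i, |K i j| * ∑ s, (h s i - h s j) ^ 2 ≤ ε) (x : n → ℝ) :
    ∑ s, (h s * x) ⬝ᵥ (K *ᵥ (h s * x)) - ε / 2 * (x ⬝ᵥ x) ≤ x ⬝ᵥ (K *ᵥ x) := by
  have habs : ∀ i j, |imsError K h i j| = |K i j| * ∑ s, (h s i - h s j) ^ 2 := by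
    intro i j
    have hnn : 0 ≤ ∑ s, (h s i - h s j) ^ 2 := Finset.sum_nonneg fun s _ => sq_nonneg _
    rw [imsError, Matrix.of_apply, abs_mul, abs_of_nonneg hnn]
  have hR : ∀ i, ∑ j, |imsError K h i j| ≤ ε := fun i => by simp_rw [habs]; exact hrow i
  have hC : ∀ j, ∑ i, |imsError K h i j| ≤ ε := fun j => by simp_rw [habs]; exact hcol j
  have hE := form_abs_le_of_schur (imsError K h) hε (by nlinarith : ε * ε ≤ ε ^ 2) hR hC x
  rw [ims_localization K h hpart x]
  have := neg_abs_le (x ⬝ᵥ (imsError K h *ᵥ x))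
  linarith

end ims

end Literature.MathematicalPhysics.QuantumFieldTheory.Balaban1983to89.B9SectEKernel
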